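import Literature.Analysis.FluidPDE.NovackMatrixKernel
import Literature.Analysis.FluidPDE.NovackKernelFamily
import Literature.Analysis.FluidPDE.EyinkUniformDefect
import HarnessLib

/-!
# The flux of Novack's combined kernels concentrates on the sphere (Novack 2024, §2 Steps 1–2)

Topic: Analysis/FluidPDE, proofs towards the named fact `Torus.novack2024_longAvg_balance`
(`Literature.Analysis.FluidPDE.NovackLongitudinalBalance`): the limit `γ → 0` of the **right-hand
side** of the combined scale balance, i.e. of the flux pairing
`∫₀ᵀ∫ ψ 𝒟_{M_{ℓ,γ}}(u)` of the smooth combined kernels `M_{ℓ,γ}` (`Torus.novackKernel`,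
`Literature.Analysis.FluidPDE.NovackKernelFamily`) through the matrix flux `Torus.matKernelFlux`
(`Literature.Analysis.FluidPDE.NovackMatrixKernel`).

M. Novack, *Scaling laws and exact results in turbulence*, Nonlinearity 37 (2024) 095002, §2:
in Step 1 the flux term (DR) is rewritten "changing to spherical variables `y → (r, σ)`" and, "when
`γ → 0`, we use (dumber:bound) to pass to the limit and obtain that (DR) converges to
`(d/(2ℓ)) ∫∫⨍ φ yʲδuʲ|δu|²(ℓy)`" ((D:I:ell:0)); Step 2 runs the same limit for the longitudinal
line of (mess:one), the transverse remainder being removed by the kernel `ζ_{ℓ,γ}` ((ODE)).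

## Contents (all proved)

* `Torus.sum_fderiv_novackKernelE_mul_mul_mul`: the cubic contraction of the derivative of the
  combined kernel is purely longitudinal,
  `∑ᵢⱼₖ ∂ₖM_{ℓ,γ}^{ij}(w) aᵢaⱼaₖ = 2c_ℓ χ'_{ℓ,γ}(|w|²) ⟪a, w⟫³` (the transverse/energy terms cancel
  because `ζ_{ℓ,γ}` solves the (ODE));
* `Torus.matKernelFlux_novackKernel_eq_integral`: unfolding the torus flux onto `ℝ^d`,
  `𝒟_{M_{ℓ,γ}}(v)(x) = ∫_{ℝ^d} 2c_ℓ χ'(|ξ|²) ⟪δv(x;ξ), ξ⟫³ dξ` for `v ∈ L³(T^d)`;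
* `Torus.integral_matKernelFlux_novackKernel_eq_radial`: polar coordinates,
  `∫∫ψ𝒟_{M_{ℓ,γ}} = 2c_ℓ|S^{d−1}| ∫_{r>0} r^{d+2} χ'_{ℓ,γ}(r²) I_L(r) dr` with the longitudinal shell
  pairing `I_L(r) = ∫_{(0,T)×T^d} ⨍ (δu(rω)·ω)³ dω ψ` (the tree's `Torus.cubicShellPairing` for the
  cubic form `⟪v,ω⟫³`, continuous in `r` by `Torus.continuous_cubicShellPairing_L`,
  `EyinkUniformDefect`);
* `Torus.tendsto_integral_novackFluxWeight_mul`: un-averaging — the nonpositive kernels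
  `2c_ℓ|S^{d−1}| r^{d+2}χ'_{ℓ,γ}(r²)` have mass between `−d/ℓ` and `−(d/ℓ)(1−γ)^{d+1}` and
  supports `[ℓ(1−γ), ℓ] → {ℓ}`;
* `Torus.tendsto_integral_matKernelFlux_novackKernel_of_test`: the limit
  `∫₀ᵀ∫ψ𝒟_{M_{ℓ,γ}}(u) → −(d/ℓ)∫₀ᵀ∫⨍(δu·ω)³(ℓω)ψ` as `γ → 0⁺`.

## References

* M. Novack, *Scaling laws and exact results in turbulence*, Nonlinearity 37 (2024) 095002,
  arXiv:2310.01375: §2 Step 1 ((DR), (D:I:ell:0)), Step 2 ((mess:one), (ODE), (last:one:L:L)),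
  Appendix Prop. 1 ((dumber:bound)). [Novack2024]
* G. L. Eyink, Nonlinearity 16 (2003) 137–145, §2 (polar coordinates in the flux). [Eyink2003]
-/

noncomputable section

open MeasureTheory MeasureTheory.Measure TopologicalSpace Set Function Filter Metric
open _root_.Topology
open scoped ENNReal NNReal Convolution InnerProductSpace RealInnerProductSpace

namespace Literature.Analysis.FluidPDE.Torus

variable {d : Type*} [Fintype d] [DecidableEq d]

/-! ## The cubic contraction of `∂M_{ℓ,γ}` is longitudinal -/

section Pointwise

variable {ℓ γ : ℝ}

/-- **The cubic contraction of the derivative of the combined kernel** (Novack 2024, §2 Step 2: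
for `φ T_L − ζ T_T` with `ζ` solving the (ODE), the transverse term of (mess:one)–(mess:two)
cancels): `∑ᵢⱼₖ ∂ₖ M_{ℓ,γ}^{ij}(w) aᵢ aⱼ aₖ = 2 c_ℓ χ'_{ℓ,γ}(|w|²) ⟪a, w⟫³`. [cite: Novack2024, Sect. 2 Step 2 (mess:one)–(ODE)] -/
theorem sum_fderiv_novackKernelE_mul_mul_mul (ℓ γ : ℝ) (w a : EuclideanSpace ℝ d) :
    ∑ i, ∑ j, ∑ k, fderiv ℝ (novackKernelE ℓ γ i j) w (EuclideanSpace.single k 1) *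
        (a i * a j * a k) =
      2 * novackKernelConst d ℓ * deriv (novackCutoff ℓ γ) (‖w‖ ^ 2) * ⟪a, w⟫ ^ 3 := by
  set χ0 := novackCutoff ℓ γ (‖w‖ ^ 2) with hχ0
  set χ1 := deriv (novackCutoff ℓ γ) (‖w‖ ^ 2) with hχ1
  set c := novackKernelConst d ℓ with hc
  set A : ℝ := ∑ k, w k * a k with hA
  set N : ℝ := ∑ i, a i * a i with hN
  have hAw : ⟪a, w⟫ = A := by
    rw [PiLp.inner_apply]
    exact Finset.sum_congr rfl fun k _ => by rw [RCLike.inner_apply, conj_trivial]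
  -- the summand, split into four elementary products
  have key : ∀ i j k, fderiv ℝ (novackKernelE ℓ γ i j) w (EuclideanSpace.single k 1) *
        (a i * a j * a k) =
      c * (-(2 * χ0)) * ((if i = j then a i * a j else 0) * (w k * a k)) +
        c * χ0 * ((if i = k then a i * a k else 0) * (w j * a j)) +
        c * χ0 * ((if j = k then a j * a k else 0) * (w i * a i)) +
        c * (2 * χ1) * ((w i * a i) * (w j * a j) * (w k * a k)) := by
    intro i j k
    rw [fderiv_novackKernelE_apply_single]
    split_ifs <;> ring
  rw [Finset.sum_congr rfl fun i _ => Finset.sum_congr rfl fun j _ =>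
    Finset.sum_congr rfl fun k _ => key i j k]
  simp only [Finset.sum_add_distrib]
  -- the four triple sums
  have f1 : ∑ i, ∑ j, ∑ k, c * (-(2 * χ0)) * ((if i = j then a i * a j else 0) * (w k * a k)) =
      c * (-(2 * χ0)) * (N * A) := by
    rw [hN, hA, Finset.sum_mul_sum, Finset.mul_sum]
    refine Finset.sum_congr rfl fun i _ => ?_
    rw [Finset.sum_comm, Finset.mul_sum]
    refine Finset.sum_congr rfl fun k _ => ?_
    rw [← Finset.mul_sum, ← Finset.sum_mul, Finset.sum_ite_eq]
    simp
  have f2 : ∑ i, ∑ j, ∑ k, c * χ0 * ((if i = k then a i * a k else 0) * (w j * a j)) =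
      c * χ0 * (N * A) := by
    rw [hN, hA, Finset.sum_mul_sum, Finset.mul_sum]
    refine Finset.sum_congr rfl fun i _ => ?_
    rw [Finset.mul_sum]
    refine Finset.sum_congr rfl fun j _ => ?_
    rw [← Finset.mul_sum, ← Finset.sum_mul, Finset.sum_ite_eq]
    simp
  have f3 : ∑ i, ∑ j, ∑ k, c * χ0 * ((if j = k then a j * a k else 0) * (w i * a i)) =
      c * χ0 * (N * A) := by
    rw [hN, hA, mul_comm (∑ i, a i * a i) _, Finset.sum_mul_sum, Finset.mul_sum]
    refine Finset.sum_congr rfl fun i _ => ?_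
    rw [Finset.mul_sum]
    refine Finset.sum_congr rfl fun j _ => ?_
    rw [← Finset.mul_sum, ← Finset.sum_mul, Finset.sum_ite_eq]
    simp only [Finset.mem_univ, if_true]
    ring
  have f4 : ∑ i, ∑ j, ∑ k, c * (2 * χ1) * ((w i * a i) * (w j * a j) * (w k * a k)) =
      c * (2 * χ1) * (A * A * A) := by
    have e1 : ∀ i j k, c * (2 * χ1) * ((w i * a i) * (w j * a j) * (w k * a k)) =
        (c * (2 * χ1) * (w i * a i) * (w j * a j)) * (w k * a k) := fun i j k => by ring
    have e2 : ∀ i j, c * (2 * χ1) * (w i * a i) * (w j * a j) * A =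
        (c * (2 * χ1) * A * (w i * a i)) * (w j * a j) := fun i j => by ring
    have e3 : ∀ i, c * (2 * χ1) * A * (w i * a i) * A =
        (c * (2 * χ1) * A * A) * (w i * a i) := fun i => by ring
    simp_rw [e1, ← Finset.mul_sum, ← hA, e2, ← Finset.mul_sum, ← hA, e3, ← Finset.mul_sum, ← hA]
    ring
  rw [f1, f2, f3, f4, hAw]
  ring

omit [DecidableEq d] in
/-- The radial profile of the cubic contraction: for `ξ ≠ 0`... in fact for every `ξ`,
`2c_ℓ χ'(|ξ|²) ⟪a, ξ⟫³ = (2c_ℓ χ'(|ξ|²)|ξ|³) ⟪a, ξ/|ξ|⟫³`. [folklore] -/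
theorem two_mul_deriv_novackCutoff_mul_inner_pow (ℓ γ : ℝ) (ξ a : EuclideanSpace ℝ d) :
    2 * novackKernelConst d ℓ * deriv (novackCutoff ℓ γ) (‖ξ‖ ^ 2) * ⟪a, ξ⟫ ^ 3 =
      (2 * novackKernelConst d ℓ * deriv (novackCutoff ℓ γ) (‖ξ‖ ^ 2) * ‖ξ‖ ^ 3) *
        ⟪a, ‖ξ‖⁻¹ • ξ⟫ ^ 3 := by
  by_cases hξ : ξ = 0
  · simp [hξ]
  · have hn : ‖ξ‖ ≠ 0 := norm_ne_zero_iff.2 hξ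
    rw [real_inner_smul_right]
    field_simp

end Pointwise

/-! ## Unfolding the flux of the combined kernel onto `ℝ^d` -/

section Unfold

variable {ℓ γ : ℝ} {v : UnitAddTorus d → EuclideanSpace ℝ d}

/-- **The radial weight** of the flux of the combined kernel, `k_{ℓ,γ}(r) = 2c_ℓ χ'_{ℓ,γ}(r²) r³`
(so that `∑ᵢⱼₖ ∂ₖM^{ij}(ξ)aᵢaⱼaₖ = k(|ξ|) ⟪a, ξ̂⟫³`; nonpositive, supported in the shell
`ℓ√(1−γ) ≤ r ≤ ℓ`). [cite: Novack2024, Sect. 2 Step 1 (DR) in spherical variables] -/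
def novackFluxWeight (ℓ γ r : ℝ) : ℝ :=
  2 * novackKernelConst d ℓ * deriv (novackCutoff ℓ γ) (r ^ 2) * r ^ 3

omit [DecidableEq d] in
/-- The radial weight is continuous. [folklore] -/
theorem continuous_novackFluxWeight (ℓ γ : ℝ) : Continuous (novackFluxWeight (d := d) ℓ γ) := by
  unfold novackFluxWeight
  exact ((continuous_const.mul (((contDiff_novackCutoff ℓ γ).continuous_deriv (by simp)).comp
    (continuous_pow 2))).mul (continuous_pow 3))

omit [Fintype d] [DecidableEq d] in
/-- `χ'_{ℓ,γ}` vanishes off `[ℓ²(1−γ), ℓ²]`: for `s > ℓ²`. [folklore] -/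
theorem deriv_novackCutoff_eq_zero_of_lt (hℓ : ℓ ≠ 0) (hγ : 0 < γ) {s : ℝ} (hs : ℓ ^ 2 < s) :
    deriv (novackCutoff ℓ γ) s = 0 := by
  have h : novackCutoff ℓ γ =ᶠ[𝓝 s] fun _ => 0 := by
    filter_upwards [Ioi_mem_nhds hs] with σ hσ
    exact novackCutoff_eq_zero hℓ hγ (le_of_lt hσ)
  rw [h.deriv_eq, deriv_const]

omit [Fintype d] [DecidableEq d] in
/-- `χ'_{ℓ,γ}` vanishes for `s < ℓ²(1−γ)`. [folklore] -/
theorem deriv_novackCutoff_eq_zero_of_lt' (hℓ : ℓ ≠ 0) (hγ : 0 < γ) {s : ℝ}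
    (hs : s < ℓ ^ 2 * (1 - γ)) : deriv (novackCutoff ℓ γ) s = 0 := by
  have h : novackCutoff ℓ γ =ᶠ[𝓝 s] fun _ => 1 := by
    filter_upwards [Iio_mem_nhds hs] with σ hσ
    exact novackCutoff_eq_one hℓ hγ (le_of_lt hσ)
  rw [h.deriv_eq, deriv_const]

omit [Fintype d] [DecidableEq d] in
/-- `χ'_{ℓ,γ} ≤ 0` (the cut-off is non-increasing). [folklore] -/
theorem deriv_novackCutoff_nonpos (hγ : 0 < γ) (s : ℝ) : deriv (novackCutoff ℓ γ) s ≤ 0 := by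
  have hanti : Antitone (novackCutoff ℓ γ) := by
    intro a b hab
    unfold novackCutoff
    refine Real.smoothTransition.monotone ?_
    have hℓ2 : 0 ≤ ℓ ^ 2 := sq_nonneg ℓ
    exact div_le_div_of_nonneg_right (by gcongr) hγ.le
  exact hanti.deriv_nonpos

omit [DecidableEq d] in
/-- The radial weight vanishes for `r > ℓ` (`0 < ℓ`, `0 < γ`). [folklore] -/
theorem novackFluxWeight_eq_zero_of_lt (hℓ : 0 < ℓ) (hγ : 0 < γ) {r : ℝ} (hr : ℓ < r) :
    novackFluxWeight (d := d) ℓ γ r = 0 := by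
  have hs : ℓ ^ 2 < r ^ 2 := by gcongr
  rw [novackFluxWeight, deriv_novackCutoff_eq_zero_of_lt hℓ.ne' hγ hs]
  ring

omit [DecidableEq d] in
/-- The radial weight, read on `ℝ^d`, is integrable (continuous with support in the closed ball
of radius `ℓ`). [folklore] -/
theorem integrable_novackFluxWeight_norm (hℓ : 0 < ℓ) (hγ : 0 < γ) :
    Integrable (fun ξ : EuclideanSpace ℝ d => novackFluxWeight (d := d) ℓ γ ‖ξ‖) volume := by
  refine Continuous.integrable_of_hasCompactSupport
    ((continuous_novackFluxWeight ℓ γ).comp continuous_norm) ?_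
  refine HasCompactSupport.of_support_subset_isCompact (isCompact_closedBall 0 ℓ) fun ξ hξ => ?_
  rw [mem_closedBall, dist_zero_right]
  by_contra h
  exact hξ (novackFluxWeight_eq_zero_of_lt hℓ hγ (not_le.1 h))

/-- **Unfolding the flux of the combined kernel onto `ℝ^d`** (Novack 2024, §2: the flux integral
of (mess:one) over `ℝ^d`; Stein–Weiss Ch. VII §2 for the periodisation): for `0 < ℓ`, `0 < γ`,
`v ∈ L³(T^d; ℝ^d)` and every `x`,
`𝒟_{M_{ℓ,γ}}(v)(x) = ∫_{ℝ^d} k_{ℓ,γ}(|ξ|) ⟪δv(x;ξ), ξ̂⟫³ dξ = ∫_{ℝ^d} 2c_ℓχ'(|ξ|²)⟪δv(x;ξ), ξ⟫³ dξ`: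
the lattice sum of the derivatives `∑ₖ ∂M^{ij}(repr z + k)` (`partialDeriv_periodize_eq_sum`)
is contracted against the `k`-independent increment `δv(x; z)`, `sum_fderiv_novackKernelE_mul_mul_mul`
turns each term into `2c_ℓχ'⟪δv, repr z + k⟫³`, and `Torus.integral_eq_integral_perSum_repr`
unfolds. [cite: Novack2024, Sect. 2 Step 2 (mess:one)] -/
theorem matKernelFlux_novackKernel_eq_integral (hℓ : 0 < ℓ) (hγ : 0 < γ) (hv : MemLp v 3 volume)
    (x : UnitAddTorus d) :
    matKernelFlux (novackKernel ℓ γ) v x =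
      ∫ ξ : EuclideanSpace ℝ d, novackFluxWeight (d := d) ℓ γ ‖ξ‖ *
        ⟪increment v ξ x, ‖ξ‖⁻¹ • ξ⟫ ^ 3 := by
  -- the Euclidean integrand and its support
  set g : EuclideanSpace ℝ d → ℝ := fun ξ =>
    novackFluxWeight (d := d) ℓ γ ‖ξ‖ * ⟪increment v ξ x, ‖ξ‖⁻¹ • ξ⟫ ^ 3 with hg
  have hg_supp : support g ⊆ closedBall 0 ℓ := by
    intro ξ hξ
    rw [mem_closedBall, dist_zero_right]
    by_contra h
    exact hξ (by simp only [hg, novackFluxWeight_eq_zero_of_lt hℓ hγ (not_le.1 h), zero_mul])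
  -- integrability of `g`: `|g| ≤ |k(|ξ|)| |δv|³`
  have hv3 : Integrable (fun y => ‖v y‖ ^ 3) volume := by
    have h := hv.integrable_norm_rpow three_ne_zero ENNReal.ofNat_ne_top
    refine h.congr (ae_of_all _ fun y => ?_)
    rw [ENNReal.toReal_ofNat]
    exact Real.rpow_natCast _ 3
  have hL : Integrable (fun y => ‖v (x + y)‖ ^ 3) volume := hv3.comp_add_left x
  have hvx : Integrable (fun y => v (x + y)) volume := (hv.integrable (by norm_num)).comp_add_left x
  have hδm : AEStronglyMeasurable (fun ξ : EuclideanSpace ℝ d => increment v ξ x) volume :=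
    (FunctionSpaces.Torus.locallyIntegrable_lift hvx).aestronglyMeasurable.sub aestronglyMeasurable_const
  have hkc : Continuous fun ξ : EuclideanSpace ℝ d => novackFluxWeight (d := d) ℓ γ ‖ξ‖ :=
    (continuous_novackFluxWeight ℓ γ).comp continuous_norm
  have hcs : HasCompactSupport fun ξ : EuclideanSpace ℝ d => novackFluxWeight (d := d) ℓ γ ‖ξ‖ := by
    refine HasCompactSupport.of_support_subset_isCompact (isCompact_closedBall 0 ℓ) fun ξ hξ => ?_
    rw [mem_closedBall, dist_zero_right]
    by_contra h
    exact hξ (novackFluxWeight_eq_zero_of_lt hℓ hγ (not_le.1 h))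
  obtain ⟨K, hK⟩ := hcs.exists_bound_of_continuous hkc
  have hK0 : 0 ≤ K := (norm_nonneg _).trans (hK 0)
  have hgm : AEStronglyMeasurable g volume :=
    hkc.aestronglyMeasurable.mul
      ((hδm.inner (𝕜 := ℝ) (measurable_unitDir.aestronglyMeasurable)).pow 3)
  have hg_int : Integrable g volume := by
    rw [← integrableOn_iff_integrable_of_support_subset hg_supp]
    have hB : IntegrableOn (fun ξ : EuclideanSpace ℝ d =>
        4 * K * (‖v (x + FunctionSpaces.Torus.proj ξ)‖ ^ 3 + ‖v x‖ ^ 3)) (closedBall 0 ℓ) volume := by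
      refine Integrable.const_mul (Integrable.add ?_ ?_) _
      · exact FunctionSpaces.Torus.integrableOn_lift_of_subset_closedBall hL subset_rfl
      · exact integrableOn_const (measure_closedBall_lt_top.ne)
    refine hB.mono' hgm.restrict (ae_of_all _ fun ξ => ?_)
    have h3 := norm_sub_pow_three_le (v (x + FunctionSpaces.Torus.proj ξ)) (v x)
    have hinner : |⟪increment v ξ x, ‖ξ‖⁻¹ • ξ⟫| ≤ ‖increment v ξ x‖ := by
      calc |⟪increment v ξ x, ‖ξ‖⁻¹ • ξ⟫| ≤ ‖increment v ξ x‖ * ‖‖ξ‖⁻¹ • ξ‖ :=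
            abs_real_inner_le_norm _ _
        _ ≤ ‖increment v ξ x‖ * 1 := by gcongr; exact norm_unitDir_le ξ
        _ = ‖increment v ξ x‖ := mul_one _
    rw [hg, norm_mul, norm_pow, Real.norm_eq_abs (⟪_, _⟫)]
    calc ‖novackFluxWeight (d := d) ℓ γ ‖ξ‖‖ * |⟪increment v ξ x, ‖ξ‖⁻¹ • ξ⟫| ^ 3
        ≤ K * ‖increment v ξ x‖ ^ 3 := by
          gcongr
          exact hK ξ
      _ ≤ K * (4 * (‖v (x + FunctionSpaces.Torus.proj ξ)‖ ^ 3 + ‖v x‖ ^ 3)) :=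
          mul_le_mul_of_nonneg_left h3 hK0
      _ = 4 * K * (‖v (x + FunctionSpaces.Torus.proj ξ)‖ ^ 3 + ‖v x‖ ^ 3) := by ring
  -- unfold both sides
  rw [show (∫ ξ : EuclideanSpace ℝ d, novackFluxWeight (d := d) ℓ γ ‖ξ‖ *
      ⟪increment v ξ x, ‖ξ‖⁻¹ • ξ⟫ ^ 3) = ∫ ξ, g ξ from rfl,
    FunctionSpaces.Torus.integral_eq_integral_perSum_repr hg_int hg_supp, matKernelFlux]
  refine integral_congr_ae (ae_of_all _ fun z => ?_)
  -- pointwise: the lattice sum of the derivatives, contracted, is the lattice sum of `g`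
  have hz : ‖FunctionSpaces.Torus.repr z‖ ≤ Fintype.card d :=
    FunctionSpaces.Torus.norm_le_card_of_mem_unitCube (FunctionSpaces.Torus.repr_mem_unitCube z)
  obtain ⟨n, hn⟩ := exists_nat_ge (ℓ + Fintype.card d)
  dsimp only
  rw [FunctionSpaces.Torus.perSum_eq_sum hg_supp hz hn]
  set δ : EuclideanSpace ℝ d := v (x + z) - v x with hδ
  set y₀ := FunctionSpaces.Torus.repr z with hy₀
  have hD : ∀ i j k, FunctionSpaces.Torus.partialDeriv k (novackKernel ℓ γ i j) z =
      ∑ k' ∈ FunctionSpaces.Torus.latticeWindow d n,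
        fderiv ℝ (novackKernelE ℓ γ i j) (y₀ + FunctionSpaces.Torus.latticeVec k')
          (EuclideanSpace.single k 1) := fun i j k =>
    partialDeriv_periodize_eq_sum ((contDiff_novackKernelE ℓ γ i j).of_le (by simp))
      (tsupport_novackKernelE_subset hℓ hγ i j) hn k z
  simp_rw [hD, Finset.sum_mul]
  -- bring the lattice sum outside
  calc ∑ i, ∑ j, ∑ k, ∑ k' ∈ FunctionSpaces.Torus.latticeWindow d n,
          fderiv ℝ (novackKernelE ℓ γ i j) (y₀ + FunctionSpaces.Torus.latticeVec k')
            (EuclideanSpace.single k 1) * (δ i * δ j * δ k)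
      = ∑ i, ∑ j, ∑ k' ∈ FunctionSpaces.Torus.latticeWindow d n, ∑ k,
          fderiv ℝ (novackKernelE ℓ γ i j) (y₀ + FunctionSpaces.Torus.latticeVec k')
            (EuclideanSpace.single k 1) * (δ i * δ j * δ k) :=
        Finset.sum_congr rfl fun i _ => Finset.sum_congr rfl fun j _ => Finset.sum_comm
    _ = ∑ i, ∑ k' ∈ FunctionSpaces.Torus.latticeWindow d n, ∑ j, ∑ k,
          fderiv ℝ (novackKernelE ℓ γ i j) (y₀ + FunctionSpaces.Torus.latticeVec k')
            (EuclideanSpace.single k 1) * (δ i * δ j * δ k) :=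
        Finset.sum_congr rfl fun i _ => Finset.sum_comm
    _ = ∑ k' ∈ FunctionSpaces.Torus.latticeWindow d n, ∑ i, ∑ j, ∑ k,
          fderiv ℝ (novackKernelE ℓ γ i j) (y₀ + FunctionSpaces.Torus.latticeVec k')
            (EuclideanSpace.single k 1) * (δ i * δ j * δ k) := Finset.sum_comm
    _ = ∑ k' ∈ FunctionSpaces.Torus.latticeWindow d n, g (y₀ + FunctionSpaces.Torus.latticeVec k') := by
        refine Finset.sum_congr rfl fun k' _ => ?_
        have hinc : increment v (y₀ + FunctionSpaces.Torus.latticeVec k') x = δ := by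
          rw [increment, FunctionSpaces.Torus.proj_add_latticeVec, hy₀, FunctionSpaces.Torus.proj_repr]
        rw [sum_fderiv_novackKernelE_mul_mul_mul, two_mul_deriv_novackCutoff_mul_inner_pow, hg]
        simp only [novackFluxWeight, hinc]

end Unfold

/-! ## Un-averaging: the radial kernels concentrate at `r = ℓ` -/

section Unaverage

variable {ℓ γ : ℝ}

/-- The derivative profile `φ_{ℓ,γ}(r) = 2r χ'_{ℓ,γ}(r²) = d/dr χ_{ℓ,γ}(r²)`. [folklore] -/
def novackShellProfile (ℓ γ r : ℝ) : ℝ :=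
  2 * r * deriv (novackCutoff ℓ γ) (r ^ 2)

omit [Fintype d] [DecidableEq d] in
/-- `r ↦ χ_{ℓ,γ}(r²)` has derivative `φ_{ℓ,γ}(r)`. [folklore] -/
theorem hasDerivAt_novackCutoff_sq (ℓ γ r : ℝ) :
    HasDerivAt (fun r => novackCutoff ℓ γ (r ^ 2)) (novackShellProfile ℓ γ r) r := by
  have h2 : HasDerivAt (fun x : ℝ => x ^ 2) (2 * r) r := by simpa using hasDerivAt_pow 2 r
  have hχ : HasDerivAt (novackCutoff ℓ γ) (deriv (novackCutoff ℓ γ) (r ^ 2)) (r ^ 2) :=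
    (((contDiff_novackCutoff ℓ γ).differentiable (by simp)) _).hasDerivAt
  have h : HasDerivAt (fun r => novackCutoff ℓ γ (r ^ 2))
      (deriv (novackCutoff ℓ γ) (r ^ 2) * (2 * r)) r :=
    HasDerivAt.comp r (h := fun x : ℝ => x ^ 2) (h₂ := novackCutoff ℓ γ) hχ h2
  rw [novackShellProfile]
  convert h using 1
  ring

omit [Fintype d] [DecidableEq d] in
/-- The profile is continuous. [folklore] -/
theorem continuous_novackShellProfile (ℓ γ : ℝ) : Continuous (novackShellProfile ℓ γ) := by
  unfold novackShellProfile
  exact (continuous_const.mul continuous_id).mul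
    (((contDiff_novackCutoff ℓ γ).continuous_deriv (by simp)).comp (continuous_pow 2))

omit [Fintype d] [DecidableEq d] in
/-- The profile is nonpositive on `r ≥ 0` (`γ > 0`). [folklore] -/
theorem novackShellProfile_nonpos (hγ : 0 < γ) {r : ℝ} (hr : 0 ≤ r) : novackShellProfile ℓ γ r ≤ 0 :=
  mul_nonpos_of_nonneg_of_nonpos (by positivity) (deriv_novackCutoff_nonpos hγ _)

omit [Fintype d] [DecidableEq d] in
/-- The profile vanishes for `r > ℓ`. [folklore] -/
theorem novackShellProfile_eq_zero_of_lt (hℓ : 0 < ℓ) (hγ : 0 < γ) {r : ℝ} (hr : ℓ < r) :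
    novackShellProfile ℓ γ r = 0 := by
  have hs : ℓ ^ 2 < r ^ 2 := by gcongr
  rw [novackShellProfile, deriv_novackCutoff_eq_zero_of_lt hℓ.ne' hγ hs, mul_zero]

omit [Fintype d] [DecidableEq d] in
/-- The profile vanishes for `0 ≤ r < ℓ(1 − γ)` (`0 < γ < 1`). [folklore] -/
theorem novackShellProfile_eq_zero_of_lt' (hℓ : 0 < ℓ) (hγ : 0 < γ) (hγ1 : γ < 1) {r : ℝ}
    (hr0 : 0 ≤ r) (hr : r < ℓ * (1 - γ)) : novackShellProfile ℓ γ r = 0 := by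
  have h1γ : 0 < 1 - γ := by linarith
  have hs : r ^ 2 < ℓ ^ 2 * (1 - γ) := by
    calc r ^ 2 < (ℓ * (1 - γ)) ^ 2 := by gcongr
      _ = ℓ ^ 2 * (1 - γ) * (1 - γ) := by ring
      _ ≤ ℓ ^ 2 * (1 - γ) * 1 := by gcongr; linarith
      _ = ℓ ^ 2 * (1 - γ) := mul_one _
  rw [novackShellProfile, deriv_novackCutoff_eq_zero_of_lt' hℓ.ne' hγ hs, mul_zero]

omit [Fintype d] [DecidableEq d] in
/-- **Unit mass of the profile**: `∫₀^ℓ φ_{ℓ,γ} = χ_{ℓ,γ}(ℓ²) − χ_{ℓ,γ}(0) = −1` (`0 < γ ≤ 1`). [folklore] -/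
theorem integral_novackShellProfile (hℓ : 0 < ℓ) (hγ : 0 < γ) (hγ1 : γ ≤ 1) :
    ∫ r in (0 : ℝ)..ℓ, novackShellProfile ℓ γ r = -1 := by
  rw [intervalIntegral.integral_eq_sub_of_hasDerivAt (fun r _ => hasDerivAt_novackCutoff_sq ℓ γ r)
    ((continuous_novackShellProfile ℓ γ).intervalIntegrable _ _)]
  have h0 : novackCutoff ℓ γ ((0 : ℝ) ^ 2) = 1 := by
    refine novackCutoff_eq_one hℓ.ne' hγ ?_
    rw [zero_pow two_ne_zero]
    exact mul_nonneg (sq_nonneg ℓ) (by linarith)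
  rw [novackCutoff_eq_zero hℓ.ne' hγ le_rfl, h0]
  ring

omit [Fintype d] [DecidableEq d] in
/-- Integrals over `(0, ∞)` of functions vanishing beyond `ℓ` are interval integrals over
`(0, ℓ)`, and continuous such functions are integrable there. [folklore] -/
theorem setIntegral_Ioi_eq_intervalIntegral_of_eq_zero (hℓ : 0 < ℓ) {F : ℝ → ℝ} (hF : Continuous F)
    (hF0 : ∀ r, ℓ < r → F r = 0) :
    IntegrableOn F (Ioi 0) ∧ ∫ r in Ioi (0 : ℝ), F r = ∫ r in (0 : ℝ)..ℓ, F r := by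
  have h0 : ∀ x ∈ Ioi (0 : ℝ) \ Ioc 0 ℓ, F x = 0 := fun x hx => by
    refine hF0 x ?_
    by_contra h
    exact hx.2 ⟨hx.1, not_lt.1 h⟩
  refine ⟨(hF.continuousOn.integrableOn_Icc (a := 0) (b := ℓ)).mono_set Ioc_subset_Icc_self
    |>.of_ae_sdiff_eq_zero measurableSet_Ioi.nullMeasurableSet (Eventually.of_forall h0), ?_⟩
  rw [setIntegral_eq_of_subset_of_forall_sdiff_eq_zero measurableSet_Ioi Ioc_subset_Ioi_self h0,
    intervalIntegral.integral_of_le hℓ.le]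

omit [DecidableEq d] in
/-- **The constant**: `|S^{d−1}| c_ℓ ℓ^{d+1} = d/ℓ` (`|B_ℓ| = |S^{d−1}| ℓ^d / d`). [folklore] -/
theorem toSphere_real_univ_mul_novackKernelConst [Nonempty d] (hℓ : 0 < ℓ) :
    (volume : Measure (EuclideanSpace ℝ d)).toSphere.real univ *
        (novackKernelConst d ℓ * ℓ ^ (Fintype.card d + 1)) = (Fintype.card d : ℝ) / ℓ := by
  have hB1 : 0 < (volume : Measure (EuclideanSpace ℝ d)).real (ball 0 1) :=
    ENNReal.toReal_pos (measure_ball_pos volume _ one_pos).ne' measure_ball_lt_top.ne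
  have hBℓ : (volume (ball (0 : EuclideanSpace ℝ d) ℓ)).toReal =
      ℓ ^ Fintype.card d * (volume : Measure (EuclideanSpace ℝ d)).real (ball 0 1) := by
    rw [Measure.addHaar_ball_of_pos volume _ hℓ, finrank_euclideanSpace, ENNReal.toReal_mul,
      ENNReal.toReal_ofReal (pow_nonneg hℓ.le _)]
    rfl
  rw [Measure.toSphere_real_apply_univ, finrank_euclideanSpace, novackKernelConst, hBℓ]
  field_simp
  ring

omit [DecidableEq d] in
/-- **Un-averaging** (Novack 2024, §2 Step 1, (DR) → (D:I:ell:0) and Appendix Prop. 1,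
(dumber:bound): "when `γ → 0` … (DR) converges to `(d/(2ℓ))∫∫⨍…(ℓy)`"): for `G` continuous,
`|S^{d−1}| ∫_{r>0} r^{d−1} k_{ℓ,γ}(r) G(r) dr → −(d/ℓ) G(ℓ)` as `γ → 0⁺` — the kernels
`r^{d−1}k_{ℓ,γ}(r) = c_ℓ r^{d+1} φ_{ℓ,γ}(r)` are nonpositive, supported in `[ℓ(1−γ), ℓ]`, of mass
between `−c_ℓℓ^{d+1}` and `−c_ℓ(ℓ(1−γ))^{d+1}`. [cite: Novack2024, Sect. 2 Step 1 (D:I:ell:0)] -/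
theorem tendsto_integral_novackFluxWeight_mul [Nonempty d] (hℓ : 0 < ℓ) {G : ℝ → ℝ}
    (hG : Continuous G) :
    Tendsto (fun γ => (volume : Measure (EuclideanSpace ℝ d)).toSphere.real univ *
        ∫ r in Ioi (0 : ℝ), r ^ (Fintype.card d - 1) * novackFluxWeight (d := d) ℓ γ r * G r)
      (𝓝[>] 0) (𝓝 (-((Fintype.card d : ℝ) / ℓ) * G ℓ)) := by
  set n : ℕ := Fintype.card d with hndef
  obtain ⟨m, hm⟩ : ∃ m : ℕ, n = m + 1 := Nat.exists_eq_succ_of_ne_zero Fintype.card_ne_zero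
  set c : ℝ := novackKernelConst d ℓ with hcdef
  set S : ℝ := (volume : Measure (EuclideanSpace ℝ d)).toSphere.real univ with hSdef
  have hc : 0 < c := by
    rw [hcdef, novackKernelConst]
    exact inv_pos.2 (mul_pos (ENNReal.toReal_pos (measure_ball_pos volume _ hℓ).ne'
      measure_ball_lt_top.ne) (by positivity))
  set Cℓ : ℝ := c * ℓ ^ (n + 1) with hCℓ
  have hCℓ0 : 0 < Cℓ := by positivity
  -- the kernels
  set K : ℝ → ℝ → ℝ := fun γ r => c * r ^ (n + 1) * novackShellProfile ℓ γ r with hKdef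
  have hKf : ∀ γ r, r ^ (n - 1) * novackFluxWeight (d := d) ℓ γ r = K γ r := by
    intro γ r
    simp only [hKdef, novackFluxWeight, novackShellProfile, hm, Nat.add_sub_cancel, ← hcdef]
    ring
  have hKc : ∀ γ, Continuous (K γ) := fun γ =>
    (continuous_const.mul (continuous_pow _)).mul (continuous_novackShellProfile ℓ γ)
  have hK0 : ∀ {γ}, 0 < γ → ∀ r, ℓ < r → K γ r = 0 := fun hγ r hr => by
    simp only [hKdef, novackShellProfile_eq_zero_of_lt hℓ hγ hr, mul_zero]
  have hK0' : ∀ {γ}, 0 < γ → γ < 1 → ∀ r, 0 ≤ r → r < ℓ * (1 - γ) → K γ r = 0 :=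
    fun hγ hγ1 r hr0 hr => by
    simp only [hKdef, novackShellProfile_eq_zero_of_lt' hℓ hγ hγ1 hr0 hr, mul_zero]
  have hKnonpos : ∀ {γ}, 0 < γ → ∀ r, 0 ≤ r → K γ r ≤ 0 := fun hγ r hr =>
    mul_nonpos_of_nonneg_of_nonpos (by positivity) (novackShellProfile_nonpos hγ hr)
  -- mass bounds: `-Cℓ ≤ ∫ K ≤ -Cℓ (1-γ)^(n+1)` for `0 < γ < 1`
  have hmass : ∀ {γ}, 0 < γ → γ < 1 →
      -Cℓ ≤ ∫ r in (0 : ℝ)..ℓ, K γ r ∧ ∫ r in (0 : ℝ)..ℓ, K γ r ≤ -(Cℓ * (1 - γ) ^ (n + 1)) := by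
    intro γ hγ hγ1
    have hφi : IntervalIntegrable (novackShellProfile ℓ γ) volume 0 ℓ :=
      (continuous_novackShellProfile ℓ γ).intervalIntegrable _ _
    have hKi : IntervalIntegrable (K γ) volume 0 ℓ := (hKc γ).intervalIntegrable _ _
    have hm1 := integral_novackShellProfile hℓ hγ hγ1.le
    constructor
    · -- lower bound: `K ≥ Cℓ φ` on `[0, ℓ]`
      have hle : ∀ r ∈ Icc (0 : ℝ) ℓ, Cℓ * novackShellProfile ℓ γ r ≤ K γ r := by
        intro r hr
        have hφ := novackShellProfile_nonpos (ℓ := ℓ) hγ hr.1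
        have hp : r ^ (n + 1) ≤ ℓ ^ (n + 1) := by gcongr; exact hr.1; exact hr.2
        simp only [hKdef, hCℓ]
        nlinarith [mul_le_mul_of_nonpos_right hp hφ, hc.le]
      have h := intervalIntegral.integral_mono_on hℓ.le (hφi.const_mul Cℓ) hKi hle
      rwa [intervalIntegral.integral_const_mul, hm1, mul_neg_one] at h
    · -- upper bound: `K ≤ Cℓ (1-γ)^(n+1) φ` on `[0, ℓ]`
      have hle : ∀ r ∈ Icc (0 : ℝ) ℓ, K γ r ≤ Cℓ * (1 - γ) ^ (n + 1) * novackShellProfile ℓ γ r := by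
        intro r hr
        by_cases hrs : r < ℓ * (1 - γ)
        · rw [hK0' hγ hγ1 r hr.1 hrs, novackShellProfile_eq_zero_of_lt' hℓ hγ hγ1 hr.1 hrs, mul_zero]
        · have hφ := novackShellProfile_nonpos (ℓ := ℓ) hγ hr.1
          have h1γ : 0 ≤ ℓ * (1 - γ) := mul_nonneg hℓ.le (by linarith)
          have hp : (ℓ * (1 - γ)) ^ (n + 1) ≤ r ^ (n + 1) := by gcongr; exact not_lt.1 hrs
          simp only [hKdef, hCℓ]
          have : Cℓ * (1 - γ) ^ (n + 1) = c * (ℓ * (1 - γ)) ^ (n + 1) := by rw [hCℓ, mul_pow]; ring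
          nlinarith [mul_le_mul_of_nonpos_right hp hφ, hc.le]
      have h := intervalIntegral.integral_mono_on hℓ.le hKi (hφi.const_mul _) hle
      rwa [intervalIntegral.integral_const_mul, hm1, mul_neg_one] at h
  -- the `ε`-argument
  have hlim : Tendsto (fun γ => ∫ r in Ioi (0 : ℝ), K γ r * G r) (𝓝[>] 0) (𝓝 (-Cℓ * G ℓ)) := by
    rw [Metric.tendsto_nhds]
    intro ε hε
    set η : ℝ := ε / (2 * (Cℓ + Cℓ * |G ℓ| + 1)) with hη
    have hden : 0 < Cℓ + Cℓ * |G ℓ| + 1 := by positivity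
    have hη0 : 0 < η := div_pos hε (mul_pos two_pos hden)
    obtain ⟨δ, hδ, hGδ⟩ : ∃ δ > 0, ∀ y, |y - ℓ| < δ → |G y - G ℓ| < η := by
      obtain ⟨δ, hδ, h⟩ := Metric.continuousAt_iff.1 (hG.continuousAt (x := ℓ)) η hη0
      exact ⟨δ, hδ, fun y hy => by simpa [Real.dist_eq] using h (by simpa [Real.dist_eq] using hy)⟩
    -- `(1 - γ)^(n+1) → 1`
    have hpow : Tendsto (fun γ : ℝ => 1 - (1 - γ) ^ (n + 1)) (𝓝[>] 0) (𝓝 0) := by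
      have h : Tendsto (fun γ : ℝ => 1 - (1 - γ) ^ (n + 1)) (𝓝 0) (𝓝 (1 - (1 - 0) ^ (n + 1))) :=
        ((continuous_const.sub ((continuous_const.sub continuous_id).pow _)).tendsto 0)
      simp only [sub_zero, one_pow, sub_self] at h
      exact h.mono_left nhdsWithin_le_nhds
    have hev1 : ∀ᶠ γ in 𝓝[>] (0 : ℝ), 1 - (1 - γ) ^ (n + 1) < η :=
      (Metric.tendsto_nhds.1 hpow) η hη0 |>.mono fun γ hγ => by
        rw [Real.dist_eq, sub_zero] at hγ
        exact (abs_lt.1 hγ).2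
    have hev2 : ∀ᶠ γ in 𝓝[>] (0 : ℝ), γ ∈ Ioo 0 (min 1 (δ / ℓ)) :=
      Ioo_mem_nhdsGT (lt_min one_pos (div_pos hδ hℓ))
    filter_upwards [hev1, hev2] with γ hγη hγ
    have hγ0 : 0 < γ := hγ.1
    have hγ1 : γ < 1 := lt_of_lt_of_le hγ.2 (min_le_left _ _)
    have hγδ : ℓ * γ < δ := by
      have := lt_of_lt_of_le hγ.2 (min_le_right _ _)
      rwa [lt_div_iff₀ hℓ, mul_comm] at this
    -- integrability on `(0, ∞)` and reduction to `(0, ℓ)`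
    obtain ⟨hKGi, -⟩ := setIntegral_Ioi_eq_intervalIntegral_of_eq_zero hℓ
      (F := fun r => K γ r * G r) ((hKc γ).mul hG) (fun r hr => by simp only [hK0 hγ0 r hr, zero_mul])
    obtain ⟨hKi, hKI⟩ := setIntegral_Ioi_eq_intervalIntegral_of_eq_zero hℓ (F := K γ) (hKc γ) (hK0 hγ0)
    obtain ⟨hm_lo, hm_hi⟩ := hmass hγ0 hγ1
    generalize hmγ : (∫ r in (0 : ℝ)..ℓ, K γ r) = mγ at hm_lo hm_hi hKI
    -- pointwise bound `|K (G - G ℓ)| ≤ -K η` on `(0, ∞)`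
    have hpt : ∀ r, 0 < r → |K γ r * (G r - G ℓ)| ≤ -K γ r * η := by
      intro r hr
      by_cases hKr : K γ r = 0
      · simp [hKr]
      · have hr1 : r ≤ ℓ := by
          by_contra h
          exact hKr (hK0 hγ0 r (not_le.1 h))
        have hr2 : ℓ * (1 - γ) ≤ r := by
          by_contra h
          exact hKr (hK0' hγ0 hγ1 r hr.le (not_le.1 h))
        have hclose : |r - ℓ| < δ := by
          rw [abs_sub_comm, abs_of_nonneg (by linarith)]
          nlinarith
        rw [abs_mul, abs_of_nonpos (hKnonpos hγ0 r hr.le)]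
        exact mul_le_mul_of_nonneg_left (hGδ r hclose).le (neg_nonneg.2 (hKnonpos hγ0 r hr.le))
    have hdiff : (∫ r in Ioi (0 : ℝ), K γ r * G r) - mγ * G ℓ =
        ∫ r in Ioi (0 : ℝ), K γ r * (G r - G ℓ) := by
      rw [← hKI, ← integral_mul_const, ← integral_sub hKGi (hKi.mul_const _)]
      refine setIntegral_congr_fun measurableSet_Ioi fun x _ => ?_
      ring
    have hI1 : |(∫ r in Ioi (0 : ℝ), K γ r * G r) - mγ * G ℓ| ≤ Cℓ * η := by
      rw [hdiff]
      calc |∫ r in Ioi (0 : ℝ), K γ r * (G r - G ℓ)|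
          ≤ ∫ r in Ioi (0 : ℝ), |K γ r * (G r - G ℓ)| := abs_integral_le_integral_abs
        _ ≤ ∫ r in Ioi (0 : ℝ), -K γ r * η := by
            refine setIntegral_mono_on ?_ ((hKi.neg.mul_const η)) measurableSet_Ioi
              fun r hr => hpt r hr
            exact (hKGi.sub (hKi.mul_const (G ℓ))).abs.congr
              (ae_of_all _ fun x => by simp only [Pi.sub_apply]; ring_nf)
        _ = -mγ * η := by rw [integral_mul_const, integral_neg, hKI]
        _ ≤ Cℓ * η := by nlinarith
    have hI2 : |mγ * G ℓ - -Cℓ * G ℓ| ≤ Cℓ * |G ℓ| * η := by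
      rw [show mγ * G ℓ - -Cℓ * G ℓ = (mγ + Cℓ) * G ℓ by ring, abs_mul]
      have h1 : |mγ + Cℓ| ≤ Cℓ * (1 - (1 - γ) ^ (n + 1)) := by
        rw [abs_of_nonneg (by linarith)]
        nlinarith
      calc |mγ + Cℓ| * |G ℓ| ≤ Cℓ * (1 - (1 - γ) ^ (n + 1)) * |G ℓ| := by gcongr
        _ ≤ Cℓ * η * |G ℓ| := by gcongr
        _ = Cℓ * |G ℓ| * η := by ring
    rw [Real.dist_eq]
    calc |(∫ r in Ioi (0 : ℝ), K γ r * G r) - -Cℓ * G ℓ|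
        ≤ |(∫ r in Ioi (0 : ℝ), K γ r * G r) - mγ * G ℓ| + |mγ * G ℓ - -Cℓ * G ℓ| := abs_sub_le _ _ _
      _ ≤ Cℓ * η + Cℓ * |G ℓ| * η := add_le_add hI1 hI2
      _ = (Cℓ + Cℓ * |G ℓ|) * η := by ring
      _ < ε := by
          rw [hη, ← mul_div_assoc, div_lt_iff₀ (mul_pos two_pos hden)]
          nlinarith [mul_nonneg (add_nonneg hCℓ0.le (mul_nonneg hCℓ0.le (abs_nonneg (G ℓ)))) hε.le]
  -- conclusion
  have hfun : (fun γ => S * ∫ r in Ioi (0 : ℝ), r ^ (n - 1) * novackFluxWeight (d := d) ℓ γ r * G r) =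
      fun γ => S * ∫ r in Ioi (0 : ℝ), K γ r * G r := by
    funext γ
    simp_rw [hKf]
  have hconst : S * (-Cℓ * G ℓ) = -((n : ℝ) / ℓ) * G ℓ := by
    rw [hCℓ, ← toSphere_real_univ_mul_novackKernelConst (d := d) hℓ, ← hSdef, ← hcdef, ← hndef]
    ring
  rw [hfun, ← hconst]
  exact hlim.const_mul S

end Unaverage

/-! ## The limit `γ → 0` of the flux pairing -/

section Limit

variable {T : ℝ} {u : ℝ → UnitAddTorus d → EuclideanSpace ℝ d} {ψ : ℝ → UnitAddTorus d → ℝ} {Cψ : ℝ}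
  {ℓ γ : ℝ}

omit [DecidableEq d] in
/-- Almost every space–time point has an `L³` velocity slice. [folklore] -/
theorem ae_memLp_three_slice
    (hu : AEStronglyMeasurable (uncurry u) ((volume.restrict (Ioo 0 T)).prod volume))
    (hu3 : ∫⁻ p, ‖uncurry u p‖ₑ ^ 3 ∂((volume.restrict (Ioo 0 T)).prod volume) < ∞) :
    ∀ᵐ p : ℝ × UnitAddTorus d ∂((volume.restrict (Ioo 0 T)).prod volume), MemLp (u p.1) 3 volume := by
  have hu3' : ∫⁻ z, ‖u z.1 z.2‖ₑ ^ (3 : ℝ) ∂((volume.restrict (Ioo 0 T)).prod volume) < ⊤ := by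
    have e : ∫⁻ z : ℝ × UnitAddTorus d, ‖u z.1 z.2‖ₑ ^ (3 : ℝ) ∂((volume.restrict (Ioo 0 T)).prod volume) =
        ∫⁻ p, ‖uncurry u p‖ₑ ^ 3 ∂((volume.restrict (Ioo 0 T)).prod volume) :=
      lintegral_congr fun z => by rw [ENNReal.rpow_ofNat]; rfl
    rw [e]
    exact hu3
  have h := FunctionSpaces.Torus.ae_memLp_of_lintegral_prod_rpow_lt_top hu (by norm_num : (0:ℝ) < 3) hu3'
  have h3 : ENNReal.ofReal 3 = 3 := by norm_num
  rw [h3] at h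
  exact (Measure.quasiMeasurePreserving_fst (μ := volume.restrict (Ioo 0 T))
    (ν := (volume : Measure (UnitAddTorus d)))).ae h

/-- **The flux pairing of the combined kernels in polar coordinates** (Novack 2024, §2 Step 1,
(DR) "changing to spherical variables", run for the longitudinal line of (mess:one)): for
`u ∈ L³((0,T) × T^d)`, bounded measurable `ψ`, `0 < ℓ`, `0 < γ`,
`∫_{(0,T)×T^d} 𝒟_{M_{ℓ,γ}}(u) ψ = |S^{d−1}| ∫_{r>0} r^{d−1} k_{ℓ,γ}(r) I_L(r) dr`. [cite: Novack2024, Sect. 2 Step 1 (DR)] -/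
theorem integral_matKernelFlux_novackKernel_eq_radial [Nonempty d] (hℓ : 0 < ℓ) (hγ : 0 < γ)
    (hu : AEStronglyMeasurable (uncurry u) ((volume.restrict (Ioo 0 T)).prod volume))
    (hu3 : ∫⁻ p, ‖uncurry u p‖ₑ ^ 3 ∂((volume.restrict (Ioo 0 T)).prod volume) < ∞)
    (hψm : AEStronglyMeasurable (uncurry ψ) ((volume.restrict (Ioo 0 T)).prod volume))
    (hψb : ∀ t x, |ψ t x| ≤ Cψ) :
    ∫ p, matKernelFlux (novackKernel ℓ γ) (u p.1) p.2 * ψ p.1 p.2 ∂((volume.restrict (Ioo 0 T)).prod volume) =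
      (volume : Measure (EuclideanSpace ℝ d)).toSphere.real univ *
        ∫ r in Ioi (0 : ℝ), r ^ (Fintype.card d - 1) * novackFluxWeight (d := d) ℓ γ r *
          cubicShellPairing (fun (ω v : EuclideanSpace ℝ d) => ⟪v, ω⟫ ^ 3) T u ψ r := by
  have heq : ∀ᵐ p ∂((volume.restrict (Ioo 0 T)).prod volume),
      matKernelFlux (novackKernel ℓ γ) (u p.1) p.2 * ψ p.1 p.2 =
        (∫ ξ : EuclideanSpace ℝ d, novackFluxWeight (d := d) ℓ γ ‖ξ‖ *
          (fun (ω v : EuclideanSpace ℝ d) => ⟪v, ω⟫ ^ 3) (‖ξ‖⁻¹ • ξ) (increment (u p.1) ξ p.2)) * ψ p.1 p.2 :=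
    (ae_memLp_three_slice hu hu3).mono fun p hp => by
      rw [matKernelFlux_novackKernel_eq_integral hℓ hγ hp p.2]
  rw [integral_congr_ae heq]
  exact integral_kernel_increment_eq_polar hu hu3 hψm hψb continuous_cubicFormL zero_le_one
    (fun _ v hω => abs_cubicFormL_le v hω) (integrable_novackFluxWeight_norm hℓ hγ)

/-- The flux pairing, iterated form equals product form: the integrand `𝒟_{M_{ℓ,γ}}(u) ψ` is
integrable on `(0,T) × T^d`. [folklore] -/
theorem integrable_matKernelFlux_novackKernel_mul (hℓ : 0 < ℓ) (hγ : 0 < γ)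
    (hu : AEStronglyMeasurable (uncurry u) ((volume.restrict (Ioo 0 T)).prod volume))
    (hu3 : ∫⁻ p, ‖uncurry u p‖ₑ ^ 3 ∂((volume.restrict (Ioo 0 T)).prod volume) < ∞)
    (hψm : AEStronglyMeasurable (uncurry ψ) ((volume.restrict (Ioo 0 T)).prod volume))
    (hψb : ∀ t x, |ψ t x| ≤ Cψ) :
    Integrable (fun p : ℝ × UnitAddTorus d => matKernelFlux (novackKernel ℓ γ) (u p.1) p.2 * ψ p.1 p.2)
      ((volume.restrict (Ioo 0 T)).prod volume) := by
  have hFi := integrable_kernel_increment hu hu3 hψm hψb continuous_cubicFormL zero_le_one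
    (fun _ v hω => abs_cubicFormL_le v hω) (integrable_novackFluxWeight_norm (d := d) hℓ hγ)
  have hI := hFi.integral_prod_left
  refine hI.congr ((ae_memLp_three_slice hu hu3).mono fun p hp => ?_)
  dsimp only
  rw [matKernelFlux_novackKernel_eq_integral hℓ hγ hp p.2, ← integral_mul_const]

omit [DecidableEq d] in
/-- The pairing of the longitudinal structure function with `ψ` is integrable on `(0,T) × T^d`
(so that its iterated integral is the longitudinal shell pairing). [folklore] -/
theorem integrable_longitudinalFluxSphereAvg_mul [Nonempty d]
    (hu : AEStronglyMeasurable (uncurry u) ((volume.restrict (Ioo 0 T)).prod volume))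
    (hu3 : ∫⁻ p, ‖uncurry u p‖ₑ ^ 3 ∂((volume.restrict (Ioo 0 T)).prod volume) < ∞)
    (hψm : AEStronglyMeasurable (uncurry ψ) ((volume.restrict (Ioo 0 T)).prod volume))
    (hψb : ∀ t x, |ψ t x| ≤ Cψ) (r : ℝ) :
    Integrable (fun p : ℝ × UnitAddTorus d => longitudinalFluxSphereAvg (u p.1) r p.2 * ψ p.1 p.2)
      ((volume.restrict (Ioo 0 T)).prod volume) := by
  set c : ℝ := (volume : Measure (EuclideanSpace ℝ d)).toSphere.real univ with hcdef
  have hc : 0 < c := toSphere_real_univ_pos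
  have hWi := integrable_sphere_increment hu hu3 hψm hψb continuous_cubicFormL zero_le_one
    (fun _ v hω => abs_cubicFormL_le v hω) r
  have hI := hWi.integral_prod_left
  have h4 : ∀ p : ℝ × UnitAddTorus d,
      ∫ ω : sphere (0 : EuclideanSpace ℝ d) 1,
          (fun (ω v : EuclideanSpace ℝ d) => ⟪v, ω⟫ ^ 3) ω
            (increment (u p.1) (r • (ω : EuclideanSpace ℝ d)) p.2) * ψ p.1 p.2 ∂volume.toSphere =
        c * (longitudinalFluxSphereAvg (u p.1) r p.2 * ψ p.1 p.2) := fun p => by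
    rw [integral_mul_const, integral_sphere_eq_mul_sphereAvg
      (fun y => (fun (ω v : EuclideanSpace ℝ d) => ⟪v, ω⟫ ^ 3) y (increment (u p.1) (r • y) p.2)),
      mul_assoc]
    rfl
  have hI' : Integrable (fun p : ℝ × UnitAddTorus d =>
      c * (longitudinalFluxSphereAvg (u p.1) r p.2 * ψ p.1 p.2)) ((volume.restrict (Ioo 0 T)).prod volume) :=
    hI.congr (ae_of_all _ h4)
  have := hI'.const_mul c⁻¹
  refine this.congr (ae_of_all _ fun p => ?_)
  simp only
  rw [← mul_assoc, inv_mul_cancel₀ hc.ne', one_mul]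

/-- **The flux of Novack's combined kernels concentrates on the sphere** (Novack 2024, §2
Steps 1–2: (DR) → (D:I:ell:0) via (dumber:bound), run for the longitudinal line of (mess:one)
with the transverse remainder removed by `ζ_{ℓ,γ}`): for `u ∈ L³((0,T) × T^d)` jointly
measurable, `0 < ℓ` and a test function `ψ` supported in `(0,T)`,
`∫₀ᵀ∫ 𝒟_{M_{ℓ,γ}}(u) ψ → −(d/ℓ) ∫₀ᵀ∫ ⨍_{S^{d−1}} (δu(t,x;ℓω)·ω)³ dω ψ` as `γ → 0⁺` — the
content of the named fact `Torus.tendsto_integral_matKernelFlux_novackKernel`. [cite: Novack2024, Sect. 2 Step 2 (last:one:L:L), limit γ → 0] -/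
theorem tendsto_integral_matKernelFlux_novackKernel_of_test [Nonempty d]
    (hmeas : AEStronglyMeasurable (FunctionSpaces.Torus.stLift u) (volume.restrict (Ioo 0 T ×ˢ univ)))
    (hu3 : ∫⁻ t in Ioo 0 T, ∫⁻ x, ‖u t x‖ₑ ^ 3 < ⊤) (hℓ : 0 < ℓ)
    (hψ : FunctionSpaces.Torus.IsSpaceTimeTestIoo T ψ) :
    Tendsto (fun γ => ∫ t in Ioo 0 T, ∫ x, matKernelFlux (novackKernel ℓ γ) (u t) x * ψ t x)
      (𝓝[>] 0)
      (𝓝 (-((Fintype.card d : ℝ) / ℓ) *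
        ∫ t in Ioo 0 T, ∫ x, longitudinalFluxSphereAvg (u t) ℓ x * ψ t x)) := by
  set μp : Measure (ℝ × UnitAddTorus d) := (volume.restrict (Ioo 0 T)).prod volume with hμp
  have hum : AEStronglyMeasurable (uncurry u) μp := aestronglyMeasurable_uncurry_prod hmeas
  have hU3 : ∫⁻ p, ‖uncurry u p‖ₑ ^ 3 ∂μp < ∞ := lintegral_prod_enorm_pow_three_lt_top hum hu3
  have hψm : AEStronglyMeasurable (uncurry ψ) μp := hψ.continuous_uncurry.aestronglyMeasurable
  obtain ⟨Cψ, hψb⟩ := hψ.exists_abs_le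
  -- product forms of the two pairings
  have hL : ∀ {γ}, 0 < γ → ∫ t in Ioo 0 T, ∫ x, matKernelFlux (novackKernel ℓ γ) (u t) x * ψ t x =
      ∫ p, matKernelFlux (novackKernel ℓ γ) (u p.1) p.2 * ψ p.1 p.2 ∂μp := fun hγ =>
    (integral_prod _ (integrable_matKernelFlux_novackKernel_mul hℓ hγ hum hU3 hψm hψb)).symm
  have hR : ∫ t in Ioo 0 T, ∫ x, longitudinalFluxSphereAvg (u t) ℓ x * ψ t x =
      cubicShellPairing (fun (ω v : EuclideanSpace ℝ d) => ⟪v, ω⟫ ^ 3) T u ψ ℓ := by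
    rw [cubicShellPairing_apply]
    exact (integral_prod _ (integrable_longitudinalFluxSphereAvg_mul hum hU3 hψm hψb ℓ)).symm
  -- the radial formula, eventually, and the un-averaging
  have hev : (fun γ => ∫ t in Ioo 0 T, ∫ x, matKernelFlux (novackKernel ℓ γ) (u t) x * ψ t x) =ᶠ[𝓝[>] 0]
      fun γ => (volume : Measure (EuclideanSpace ℝ d)).toSphere.real univ *
        ∫ r in Ioi (0 : ℝ), r ^ (Fintype.card d - 1) * novackFluxWeight (d := d) ℓ γ r *
          cubicShellPairing (fun (ω v : EuclideanSpace ℝ d) => ⟪v, ω⟫ ^ 3) T u ψ r := by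
    filter_upwards [self_mem_nhdsWithin] with γ hγ
    rw [hL hγ, integral_matKernelFlux_novackKernel_eq_radial hℓ hγ hum hU3 hψm hψb]
  rw [hR]
  exact (tendsto_integral_novackFluxWeight_mul hℓ
    (continuous_cubicShellPairing_L hum hU3 hψm hψb)).congr' hev.symm

end Limit

end Literature.Analysis.FluidPDE.Torus
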